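import Summits.QuantumFields.YangMills.Theorems.BalabanUVNodesN12RootedForestLam
import Literature.MathematicalPhysics.QuantumFieldTheory.Balaban1983to89.B15DeterminingSetsBEndpoints
import HarnessLib

/-!
# BalabanUVNodes ∕ N12 — THE PRINT-ROOTED FOREST WITH ITS NONEMPTINESS ROW DISCHARGED: at every (B) sequence with a `Γ`-site (the lane's end-point cover `B15DeterminingSetsBEndpoints`)
# and at the RECORD's `maxDomT M₁ Z` (dag-n12-w3's coverage letter `hcov_Bj`) — the `hne` row of this seat's `…RootedForestLam.exists_rootedForest_lamBondsSeq` removed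

[Balaban1984PropagatorsII] = «[II]», (2.3) p. 224; [Balaban1988Convergent] = «[III]», (2.2) p. 255, (2.13) pp. 256–257; [Balaban1985Variational] = «[15]», (4) p. 278, (16)–(18) p. 280;
[Balaban1985RegularSpaces] = «[6]», (1.14) p. 78, (1.19) p. 79.

Cell `pub-ymgap` (HUMAN RULINGS D-0062 ∕ D-0149), WIDTH SEAT `pub-ymgap-dag-n12-w6` g24 (node N12 = [B15]; key K1⁹ `stmt-QuantumFields-27364`, `--kind proof --supports … --as helper`;
count-neutral).  THEOREMS ONLY (0 `def`, 0 `instance`, 0 `sorry`); by name over this seat's ✓p776028 `…RootedForestLam.exists_rootedForest_lamBondsSeq`, the lane's (dag-n12-c g36)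
`B15DeterminingSetsBEndpoints.exists_mem_lamBondsSeq_of_mem_genSet` ∕ `exists_mem_lamBondsSeq_maxDomT_of_mem_Bj` (every `Γ_j^{(j)}`-site is an end-point of a `Λ_j`-bond: its in-block
neighbour bond, [II] (2.3)), and dag-n12-w3's `N12FlatHndRecordLetters.hcov_Bj` (every fine site's block tower meets a member of `𝐁_k(Z)`).

WHY.  The (F) layer of the (ii) split at print's datum needs the rooted forest with roots at the PRINT tower sites as a hypothesis-free object at the record, exactly as w3's
`exists_rootedForest_Bj` is at reading (b); ✓p776028 displayed the nonemptiness of print's root set (`hne`).  The lane's end-point cover discharges it: `hcov_Bj` gives a member SITE,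
`exists_mem_lamBondsSeq_maxDomT_of_mem_Bj` a PRINT bond at it.

CONTENTS (namespace `Summit.QuantumFields.YangMills.BalabanUVNodes.N12RootedForestLamOfRecord`): ★ `exists_rootedForest_lamBondsSeq_of_mem_genSet` (any `Ω` with (B) at `j+1` when `j < k`,
one `Γ_j^{(j)}`-site), ★★ `exists_rootedForest_lamBondsSeq_maxDomT` (the record: `1 ≤ k ≤ m + K`, `1 ≤ M₁`, cover divisibility — the binders of w3's `exists_rootedForest_Bj`, conclusion on
print's bonds).

HONEST FRAMING.  Bookkeeping by name; nothing of Bałaban's estimates asserted or refuted; count-neutral helper; N12 NOT discharged; K0⁷∕K1⁹ NOT closed; counts of record unmoved; one finite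
𝕋⁴ programme at fixed ε — R4 closes the conditional rung `BalabanLadder.UV` only; the Yang–Mills mass gap (Clay) is NOT proved by any of this; nothing continuum ∕ ℝ⁴ ∕ OS.
-/

noncomputable section

namespace Summit.QuantumFields.YangMills.BalabanUVNodes.N12RootedForestLamOfRecord

open Literature.MathematicalPhysics.QuantumFieldTheory.Balaban1983to89
open T4Continuum
open B15DeterminingSets B15DeterminingSetsB
open B14.Eq22Determines (IsBlockUnion)
open B14.Eq213DetSet (Bj maxDomT)
open B14.Eq213MaximalDomains (side)
open B5Eq118OneStroke (iterBlockOf)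
open B15DeterminingSetsBEndpoints (exists_mem_lamBondsSeq_of_mem_genSet exists_mem_lamBondsSeq_maxDomT_of_mem_Bj)
open Summit.QuantumFields.YangMills.BalabanUVNodes.N12RootedForestLam (exists_rootedForest_lamBondsSeq)

variable {P : Params} {k : ℕ}

/-- ★ **THE PRINT-ROOTED FOREST FROM ONE `Γ`-SITE** (any sequence `Ω`, `k ≤ m + K`, `Ω_{j+1}` a union of `(j+1)`-blocks when `j < k`): a `Γ_j^{(j)}`-site `y` is an end-point of a print bond
(the lane's `exists_mem_lamBondsSeq_of_mem_genSet`), so print's root set is nonempty and ✓p776028's forest exists: (F1) ∧ (F2) on `lamBondsSeq Ω k` ∧ (TREE).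
[cite: Balaban1984PropagatorsII, (2.3) p.224; Balaban1988Convergent, (2.2) p.255, (2.13) pp.256–257; Balaban1985Variational, (4) p.278] -/
theorem exists_rootedForest_lamBondsSeq_of_mem_genSet {Ω : ℕ → Set (Site P 0)} (hk : k ≤ P.m + P.K) {j : ℕ} (hj : j ≤ k)
    (hΩ : j < k → IsBlockUnion (j + 1) (Ω (j + 1))) {y : Site P j} (hy : y ∈ genSet Ω k j) :
    ∃ path : Site P 0 → List (LStep P 0),
      (∀ x, ∀ s ∈ path x, ∃ x' x'' : Site P 0, path x'' = path x' ++ [s] ∧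
        (s.fwd = true → s.bond.src = x' ∧ s.bond.tgt = x'') ∧ (s.fwd = false → s.bond.src = x'' ∧ s.bond.tgt = x')) ∧
      (∀ j, j ≤ k → ∀ c ∈ lamBondsSeq Ω k j, path (embIter j c.src) = [] ∧ path (embIter j c.tgt) = []) ∧
      (∀ x : Site P 0, x ∉ {z : Site P 0 | ∃ j, j ≤ k ∧ ∃ c ∈ lamBondsSeq Ω k j, (z = embIter j c.src ∨ z = embIter j c.tgt)} →
        ∃ (x' : Site P 0) (s : LStep P 0), path x = path x' ++ [s] ∧
          (s.fwd = true → s.bond.src = x' ∧ s.bond.tgt = x) ∧ (s.fwd = false → s.bond.src = x ∧ s.bond.tgt = x')) := by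
  obtain ⟨c, hc, -⟩ := exists_mem_lamBondsSeq_of_mem_genSet Ω hk hΩ hy
  exact exists_rootedForest_lamBondsSeq ⟨j, hj, c, hc⟩

/-- ★★ **THE PRINT-ROOTED FOREST AT THE RECORD's `maxDomT M₁ Z`, HYPOTHESIS-FREE** (`1 ≤ k ≤ m + K`, `1 ≤ M₁`, cover divisibility — the binders of w3's `exists_rootedForest_Bj`): (F1)
prefix∕orientation, (F2) roots at `ι_j c±` for every print bond `c ∈ lamBondsSeq (maxDomT M₁ Z) k j`, `j ≤ k`, (TREE).  Nonemptiness: `hcov_Bj` gives a member site of `𝐁_k(Z)`, the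
lane's `exists_mem_lamBondsSeq_maxDomT_of_mem_Bj` a print bond at it. [cite: Balaban1984PropagatorsII, (2.3) p.224; Balaban1988Convergent, (2.2) p.255, (2.13) pp.256–257; Balaban1985Variational, (4) p.278, (16)–(18) p.280; Balaban1985RegularSpaces, (1.19) p.79] -/
theorem exists_rootedForest_lamBondsSeq_maxDomT {M₁ : ℕ} {Z : Set (Site P 0)} (hk : k ≤ P.m + P.K) (hk1 : 1 ≤ k) (hM : 1 ≤ M₁)
    (hdiv : side P.L M₁ k ∣ P.sitesPerDir 0) :
    ∃ path : Site P 0 → List (LStep P 0),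
      (∀ x, ∀ s ∈ path x, ∃ x' x'' : Site P 0, path x'' = path x' ++ [s] ∧
        (s.fwd = true → s.bond.src = x' ∧ s.bond.tgt = x'') ∧ (s.fwd = false → s.bond.src = x'' ∧ s.bond.tgt = x')) ∧
      (∀ j, j ≤ k → ∀ c ∈ lamBondsSeq (maxDomT M₁ Z) k j, path (embIter j c.src) = [] ∧ path (embIter j c.tgt) = []) ∧
      (∀ x : Site P 0, x ∉ {z : Site P 0 | ∃ j, j ≤ k ∧ ∃ c ∈ lamBondsSeq (maxDomT M₁ Z) k j, (z = embIter j c.src ∨ z = embIter j c.tgt)} →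
        ∃ (x' : Site P 0) (s : LStep P 0), path x = path x' ++ [s] ∧
          (s.fwd = true → s.bond.src = x' ∧ s.bond.tgt = x) ∧ (s.fwd = false → s.bond.src = x ∧ s.bond.tgt = x')) := by
  obtain ⟨j, hj, hy⟩ := N12FlatHndRecordLetters.hcov_Bj hM hk1 hk hdiv (default : Site P 0)
  obtain ⟨c, hc, -⟩ := exists_mem_lamBondsSeq_maxDomT_of_mem_Bj hM Z hk hdiv hy
  exact exists_rootedForest_lamBondsSeq ⟨j, hj, c, hc⟩

end Summit.QuantumFields.YangMills.BalabanUVNodes.N12RootedForestLamOfRecord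

end
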